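import Summits.CriticalPhenomena.PercolationContinuityZ3.Theorems.Transplant.SkelPhiConcFaceContact
import Summits.CriticalPhenomena.PercolationContinuityZ3.Theorems.Transplant.SkelPhiConcFaceKits
import HarnessLib

/-!
# D″ node, (F) part 10 at φ-level (DPRIME-SCOPE §2 L6′, M.9, R1; hp-8 column): the ROUTE CLAUSE OF EVERY DEEP CONTACT OF THE FACE STEP —
# the `hroute` hypothesis of part 9's `hkits_faceStepW'` DISCHARGED by part 8's `routeClause_of_schedChain` from a SCHEDULE FAMILY
# `Sch : V → ChainPlanar.Schedule` (one planar schedule about every prospective kit centre `c` of the enlarged face row; the (F) schedule of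
# record — first hop + short-stride prefix + long strides, `(Band short).append (Band long)` — is ONE instance, typed planar-side once
# addendum N fixes the strides) with its planar facts, the ∀-length chain property, and the inner kits kept ABSTRACT (`hKits`, p1-g9's
# `kitsAt_stepA_win′`) — φ-level re-cut of `SkelConcFaceRouteKits.hroute_face_kits` (hp-8 g25)

builds on p205010 (kernel theorem, internal audit signed; external expert review pending) — nothing in this file uses p205010.
Lane `prim-bschramm`, seat `prim-hp-8` (gen 30; L6′ (F) owner); helper file (`--supports stmt-CriticalPhenomena-4575`).
* `coreT_subset_faceStepW_T (hlip) (hstep)` — the far-core window of any schedule whose last core sits in the cube `M(x + du)` lies in the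
  face step's target `M_{a'}(x + du) ∪ rim` (span part within `rM − L'` of the root, rim part beyond);
* `φ_rectCtr_mem_Icc` (the kit centre of a contact of level `j' ≤ Rlev` has its footprint in the `Rlev`-enlarged face row);
* **`hroute_faceStepW_of_sched (hlip) (hstep)`** — the `hroute` of `hkits_faceStepW'`.
[cite: KozmaNitzan2024, §4 Lemma 10 Step IV (pp. 20–21), Lemma 11 (pp. 22–23), Lemma 12 (pp. 23–25), p. 30 (Step III)]
-/

noncomputable section

open MeasureTheory ProbabilityTheory
open scoped ENNReal Classical

namespace Summit.CriticalPhenomena.PercolationContinuityZ3.Theorems.Transplant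

namespace Skelφ

open Literature.Probability.Percolation Literature.Probability.LatticeModels SimpleGraph
open Literature.Probability.Percolation.KozmaNitzan
open Literature.Probability.Percolation.KozmaNitzan.Cells (oth oth_ne eq_oth_of_ne sgOf sgOf_sign)
open Literature.Barriers.CriticalPhenomena (graphBall graphBall_finite mem_graphBall_self graphBall_mono)
open KNLevels ChainPlanar
open Skel (winGraph winGraph_adj winGraph_le routeW excess)
open SkelI (tanOff)
open BoxProdZ2 (ConcRadiiG)

variable {V : Type} [DecidableEq V] [Countable V] {G : SimpleGraph V} [G.LocallyFinite] {φ : V → Site 2} {types : Finset V}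

omit [Countable V] in
/-- **The far-core window lies in the face step's target** (from `Lip`, `Steps`): a vertex within `L` of a centre `c` with `B_G(c, L) ⊆
B_G(w₀, rE)` and footprint in the last core `⊆ M(x + du)` is in the span `M_{a'}(x + du)` when within `rM − L'` of the root (`1 ≤ L' ≤ rM`),
and in the rim part of the target otherwise (`M(x + du) ⊆ farAS x du j`, `j ≤ K`). [cite: KozmaNitzan2024, §4 p. 26 (M_v), p. 30] -/
theorem coreT_subset_faceStepW_T (hlip : Lip G φ) (hstep : Steps G φ) {P : PCells2} {w₀ c : V} {Λ : ConcRadiiG} {a' : ℕ} {x : Site 2}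
    {du : MDir} {j : ℕ} (hjK : j ≤ P.K) {Rlev N M L' L : ℕ} {Sfin : Finset V} {Sch : Schedule}
    (hball : graphBall G c L ⊆ graphBall G w₀ (Λ.rE a' x du)) (hlast : Sch.core (Sch.N + 1) ⊆ P.M (x + stepVec du)) (hL'1 : 1 ≤ L')
    (hL'M : L' ≤ Λ.rM a' (x + stepVec du)) :
    (planarWindowWin hlip c L).coreT Sch Sch.N ⊆ (faceStepW G φ P w₀ Λ a' x du j Rlev N M L' Sfin).T := by
  intro v hv
  rw [PlanarWindow.coreT, planarWindowWin_W, mem_Win] at hv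
  obtain ⟨hv1, hv2⟩ := hv
  have hM : φ v ∈ P.M (x + stepVec du) := hlast hv2
  rw [faceStepW_T]
  by_cases hvm : v ∈ graphBall G w₀ (Λ.rM a' (x + stepVec du) - L')
  · refine Finset.mem_union_left _ ?_
    change v ∈ VWin G φ w₀ (P.M (x + stepVec du)) (Λ.rM a' (x + stepVec du))
    exact mem_VWin_of_zdAdj hstep hvm (by omega) hM (P.exists_adj_of_mem_M _ hM)
  · exact Finset.mem_union_right _ (Finset.mem_filter.2 ⟨(mem_Win G φ).2 ⟨hball hv1, P.M_add_stepVec_subset_farAS x du hjK hM⟩, hvm⟩)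

omit [DecidableEq V] [Countable V] [G.LocallyFinite] in
/-- A point of the `j'`-enlarged box lies in the `ρ`-enlarged box for `j' ≤ ρ`. [folklore] -/
theorem mem_Icc_enlarge_of_le {lo hi : Site 2} {j' ρ : ℕ} (hj : j' ≤ ρ) {z : Site 2}
    (hz : z ∈ Finset.Icc (lo - (j' : Site 2)) (hi + (j' : Site 2))) : z ∈ Finset.Icc (lo - (ρ : Site 2)) (hi + (ρ : Site 2)) := by
  rw [Finset.mem_Icc] at hz ⊢
  obtain ⟨h1, h2⟩ := hz
  have hj' : (j' : ℤ) ≤ ρ := by exact_mod_cast hj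
  constructor
  · intro k; have := h1 k; simp only [Pi.sub_apply, Pi.natCast_apply] at this ⊢; linarith
  · intro k; have := h2 k; simp only [Pi.add_apply, Pi.natCast_apply] at this ⊢; linarith

/-- **THE ROUTE CLAUSE OF EVERY DEEP CONTACT OF THE FACE STEP** (`hroute` of `hkits_faceStepW'`): from the Step-I′ certificate at the chain
accuracy `δA` (first-hop extent `ℓ1` certified along `du`, its rectangle `a₁`, `Rt₁`, the seed inside it), a SCHEDULE FAMILY `Sch c` about
every centre `c` with footprint in the `Rlev`-enlarged face row (core `0` holds the landing half-side; regions and last core beyond the zone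
scale along `du`, within `ℓ¹`-reach `L`, inside `farAS x du j`; last core in `M(x + du)`; first-rectangle footprint in `farAS`; level depth
`RlevA + 1 ≤ R'`), the ∀-length chain property at `(δA ↦ δ₂²)` in every inner window graph, the inner kits (abstract), the inner count and
excess radius, and the face step's law `Wt` (subbox of `winGraph G w₀ rE` on `Win w₀ (farAS) rE`, vanishing off `G`) with `1 ≤ L' ≤ rM`, `L'' ≤ L'`.
[cite: KozmaNitzan2024, §4 Lemma 10 Step IV (pp. 20–21), Lemma 11 (pp. 22–23), Lemma 12 (pp. 23–25), p. 30] -/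
theorem hroute_faceStepW_of_sched (hlip : Lip G φ) (hstep : Steps G φ) (hfr : Frames G φ types) {p : unitInterval}
    (hC : CylSubcritical G φ types p) {D : StepI.Data V} {off : ℕ} (hD : D.Λ = fatSeqOff hfr hC off) {Sz Sx Sy : Finset ℕ}
    {q : unitInterval} {δA δ₂ : ℝ} (hcert : ∀ i ∈ StepI.index types Sz Sx Sy, 1 - δA < (bondPercolation G q).real (StepI.event G φ D i))
    -- the face step
    (P : PCells2) (w₀ : V) (Λ : ConcRadiiG) (a' : ℕ) (x : Site 2) (du : MDir) {j : ℕ} (hjK : j ≤ P.K) (Rlev N M L' : ℕ) (Sfin : Finset V)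
    {Wt : Sym2 V → unitInterval} (hWG : ∀ e, e ∉ G.edgeSet → Wt e = 0)
    (hWD : IsSubbox (winGraph G w₀ (Λ.rE a' x du)) Wt q (Win G φ w₀ (P.farAS x du j) (Λ.rE a' x du)))
    (hL'1 : 1 ≤ L') (hL'M : L' ≤ Λ.rM a' (x + stepVec du)) (hL'R : L' ≤ Λ.rE a' x du) {L'' : ℕ} (hL''L' : L'' ≤ L')
    -- the kit geometry naming the centres (slab constant, kit scale, half-widths, radii, rooms — as `hkits_faceStepW'`)
    {ℓs Mk K r₀ : ℕ} {A : Fin 2 → Fin 2 → ℕ} {Rk : Fin 2 → ℕ} (hMt : tanOff ℓs Mk ≤ M + 1) (hA : ∀ i k, A i k ≤ Mk)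
    (hK : ∀ i, ℓs + 1 + A i i + Rk i ≤ K) (hr₀ : ℓs + 1 + tanOff ℓs Mk + K ≤ r₀) (hr₀R : r₀ ≤ Λ.rE a' x du) {Mz : ℕ} (hkMz : D.k ≤ Mz)
    -- the first hop along `du`
    {ℓ1 : ℕ} (hℓ1x : du.1 = 0 → ℓ1 ∈ Sx) (hℓ1y : du.1 = 1 → ℓ1 ∈ Sy) {a₁ : Fin 2 → ℕ} (ha₁ : a₁ = StepI.widths D.Gb D.Fb du.1 ℓ1)
    {Rt₁ : ℕ} (hRt₁ : Rt₁ = D.R (amax a₁)) (hka : ∀ i, D.k ≤ a₁ i) (hkR : fatRadius hfr hC D.k + off ≤ Rt₁) {L : ℕ} (hRtL : Rt₁ ≤ L)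
    -- the schedule family and its planar facts on the enlarged face row
    (Sch : V → Schedule)
    (hcore0 : ∀ c, φ c ∈ Finset.Icc (P.faceLo x du j - (Rlev : Site 2)) (P.faceHi x du j + (Rlev : Site 2)) →
      ∀ y : Site 2, y du.1 - φ c du.1 = sgOf du * a₁ du.1 → |y (oth du.1) - φ c (oth du.1)| ≤ a₁ (oth du.1) → y ∈ (Sch c).core 0)
    (hreg : ∀ c, φ c ∈ Finset.Icc (P.faceLo x du j - (Rlev : Site 2)) (P.faceHi x du j + (Rlev : Site 2)) →
      ∀ k ≤ (Sch c).N, ∀ y ∈ (Sch c).region k, (Mz : ℤ) < sgOf du * (y du.1 - φ c du.1))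
    (hlastMz : ∀ c, φ c ∈ Finset.Icc (P.faceLo x du j - (Rlev : Site 2)) (P.faceHi x du j + (Rlev : Site 2)) →
      ∀ y ∈ (Sch c).core ((Sch c).N + 1), (Mz : ℤ) < sgOf du * (y du.1 - φ c du.1))
    (hreach : ∀ c, φ c ∈ Finset.Icc (P.faceLo x du j - (Rlev : Site 2)) (P.faceHi x du j + (Rlev : Site 2)) →
      ∀ k ≤ (Sch c).N, ∃ y ∈ (Sch c).core (k + 1), (y 0 - φ c 0).natAbs + (y 1 - φ c 1).natAbs ≤ L)
    (hfar : ∀ c, φ c ∈ Finset.Icc (P.faceLo x du j - (Rlev : Site 2)) (P.faceHi x du j + (Rlev : Site 2)) →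
      ∀ k ≤ (Sch c).N, (Sch c).region k ⊆ P.farAS x du j)
    (hlast : ∀ c, φ c ∈ Finset.Icc (P.faceLo x du j - (Rlev : Site 2)) (P.faceHi x du j + (Rlev : Site 2)) →
      (Sch c).core ((Sch c).N + 1) ⊆ P.M (x + stepVec du))
    (hFfar : ∀ c, φ c ∈ Finset.Icc (P.faceLo x du j - (Rlev : Site 2)) (P.faceHi x du j + (Rlev : Site 2)) →
      Finset.Icc (φ c - fun i => ((a₁ i : ℕ) : ℤ)) (φ c + fun i => ((a₁ i : ℕ) : ℤ)) ⊆ P.farAS x du j)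
    {R' RlevA : ℕ} (hR' : ∀ c, (Sch c).R' = R') (hRl : RlevA + 1 ≤ R')
    -- the inner chain: count, rim depth, excess radius, chain property, kits
    {NA j₀A j₁A Δ' Lr R₁ : ℕ} {η : ℝ} (hjA : j₁A ≤ RlevA) (hη : η ≤ δA / 2)
    (hcountA : 1 / (1 - (q : ℝ)) ^ (Δ' * NA) ≤ δA * ((Finset.Icc j₀A j₁A).card : ℝ))
    (hR₁ : ∀ (c' : V) (R'' : ℕ), R₁ ≤ R'' → ∀ (Rw : ℕ) (D' A' : Finset V), (∀ d ∈ D', d ∈ graphBall G c' Rw) →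
      (∀ d ∈ D', ∀ d' ∈ D', φ d - φ d' ∈ box 2 (50 * P.rmax)) → A' ⊆ D' → (∀ a ∈ A', a ∈ graphBall G c' (fatRadius hfr hC D.k + off)) →
        (bondPercolation G q).real (excess G c' R'' D' A') ≤ η)
    (hR : R₁ ≤ L - Lr)
    (hchain : ∀ (c : V) (n : ℕ), (Sch c).N = n → ∀ (Wg : Sym2 V → unitInterval) (s : Fin (n + 1) → TStep (winGraph G c L))
      (T' : Fin (n + 1) → Finset V) (η : ℝ),
      (∀ i, (s i).L.o = (s 0).L.o) →
      (∀ i : Fin n, T' (Fin.castSucc i) ⊆ (s i.succ).L.X 0) →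
      (∀ i, T' i ⊆ (s i).T) →
      (∀ i, (s i).KitsAt Wg q Δ' δA) →
      η ≤ δA / 2 →
      (∀ i, (prodBernoulli Wg).real (⋃ t ∈ (s i).T \ T' i, openConn (s 0).L.o t) ≤ η) →
      1 - δA < (prodBernoulli Wg).real (s 0).L.reachB →
        1 - δ₂ ^ 2 < (prodBernoulli Wg).real (⋃ t ∈ T' (Fin.last n), openConn (s 0).L.o t))
    (hKits : ∀ c, φ c ∈ Finset.Icc (P.faceLo x du j - (Rlev : Site 2)) (P.faceHi x du j + (Rlev : Site 2)) →
      graphBall G c L ⊆ graphBall G w₀ (Λ.rE a' x du) → ∀ k ≤ (Sch c).N,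
      ((schedChain G φ c L Lr (Finset.Icc (φ c - fun i => ((a₁ i : ℕ) : ℤ)) (φ c + fun i => ((a₁ i : ℕ) : ℤ))) (Sch c) c RlevA NA j₀A
        j₁A).stepA (planarWindowWin hlip c L) (Sch c) k).KitsAt
        (routeW G Wt (schedQt G φ c L (Finset.Icc (φ c - fun i => ((a₁ i : ℕ) : ℤ)) (φ c + fun i => ((a₁ i : ℕ) : ℤ))) (Sch c)) (D.Λ c D.k))
        q Δ' δA) :
    -- the `hroute` of `hkits_faceStepW'`
    ∀ j' ∈ Finset.Icc (M + 1) Rlev,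
      ∀ y ∈ outerBoundary (winGraph G w₀ (Λ.rE a' x du)) (winLevel G φ w₀ (Λ.rE a' x du) (P.faceLo x du j) (P.faceHi x du j) j'),
      inNbr G φ w₀ (Λ.rE a' x du) (Finset.Icc (P.faceLo x du j - (j' : Site 2)) (P.faceHi x du j + (j' : Site 2))) y ∈
        graphBall G w₀ (Λ.rE a' x du - r₀) →
      graphBall G (rectCtr hstep (deepCtr G φ w₀ (Λ.rE a' x du) (P.faceLo x du j - (j' : Site 2)) (P.faceHi x du j + (j' : Site 2)) ℓs Mk y)
          (exitDir G φ w₀ (Λ.rE a' x du) (P.faceLo x du j - (j' : Site 2)) (P.faceHi x du j + (j' : Site 2)) y).1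
          (exitDir G φ w₀ (Λ.rE a' x du) (P.faceLo x du j - (j' : Site 2)) (P.faceHi x du j + (j' : Site 2)) y).2 ℓs
          (A (exitDir G φ w₀ (Λ.rE a' x du) (P.faceLo x du j - (j' : Site 2)) (P.faceHi x du j + (j' : Site 2)) y).1)) L ⊆
        graphBall G w₀ (Λ.rE a' x du - L' + L'') →
      ∃ Qt Ft : Finset V, Ft ⊆ (faceStepW G φ P w₀ Λ a' x du j Rlev N M L' Sfin).T ∧
        Qt ⊆ Win G φ w₀ (P.farAS x du j) (Λ.rE a' x du) ∧
        Disjoint Ft (D.Λ (rectCtr hstep (deepCtr G φ w₀ (Λ.rE a' x du) (P.faceLo x du j - (j' : Site 2)) (P.faceHi x du j + (j' : Site 2)) ℓs Mk y)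
          (exitDir G φ w₀ (Λ.rE a' x du) (P.faceLo x du j - (j' : Site 2)) (P.faceHi x du j + (j' : Site 2)) y).1
          (exitDir G φ w₀ (Λ.rE a' x du) (P.faceLo x du j - (j' : Site 2)) (P.faceHi x du j + (j' : Site 2)) y).2 ℓs
          (A (exitDir G φ w₀ (Λ.rE a' x du) (P.faceLo x du j - (j' : Site 2)) (P.faceHi x du j + (j' : Site 2)) y).1)) Mz) ∧
        1 - δ₂ ^ 2 < (prodBernoulli Wt).real (linkIn (↑Qt : Set V)
          (D.Λ (rectCtr hstep (deepCtr G φ w₀ (Λ.rE a' x du) (P.faceLo x du j - (j' : Site 2)) (P.faceHi x du j + (j' : Site 2)) ℓs Mk y)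
            (exitDir G φ w₀ (Λ.rE a' x du) (P.faceLo x du j - (j' : Site 2)) (P.faceHi x du j + (j' : Site 2)) y).1
            (exitDir G φ w₀ (Λ.rE a' x du) (P.faceLo x du j - (j' : Site 2)) (P.faceHi x du j + (j' : Site 2)) y).2 ℓs
            (A (exitDir G φ w₀ (Λ.rE a' x du) (P.faceLo x du j - (j' : Site 2)) (P.faceHi x du j + (j' : Site 2)) y).1)) D.k) Ft) := by
  intro j' hj' y hy hnear hball
  have hj'' : M + 1 ≤ j' ∧ j' ≤ Rlev := Finset.mem_Icc.1 hj'
  set R := Λ.rE a' x du with hRdef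
  set lo := P.faceLo x du j with hlo
  set hi := P.faceHi x du j with hhi
  have hwide : ∀ i, (lo - (j' : Site 2)) i + 2 * tanOff ℓs Mk ≤ (hi + (j' : Site 2)) i := fun i => by
    have hw := faceRow_hwide P x du j hj''.1 i; rw [← hlo, ← hhi] at hw; omega
  -- the kit rectangle of the contact lies in the shell window; name the kit centre
  have hrectS := rectPrism_subset_shellWin hlip hstep hwide hA hK hr₀ hr₀R hy hnear
  generalize (exitDir G φ w₀ R (lo - (j' : Site 2)) (hi + (j' : Site 2)) y).1 = I at hrectS hball ⊢
  generalize (exitDir G φ w₀ R (lo - (j' : Site 2)) (hi + (j' : Site 2)) y).2 = sg at hrectS hball ⊢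
  generalize deepCtr G φ w₀ R (lo - (j' : Site 2)) (hi + (j' : Site 2)) ℓs Mk y = t at hrectS hball ⊢
  set c : V := rectCtr hstep t I sg ℓs (A I) with hc
  have hcP : φ c ∈ Finset.Icc (lo - (j' : Site 2)) (hi + (j' : Site 2)) :=
    SkelI.mem_Icc_of_mem_shell ((mem_Win G φ).1 (hrectS ((mem_rectPrismFin G φ).2 (self_mem_rectPrism G φ c (A I) (Rk I))))).2
  have hcB : φ c ∈ Finset.Icc (lo - (Rlev : Site 2)) (hi + (Rlev : Site 2)) := mem_Icc_enlarge_of_le hj''.2 hcP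
  have hballR : graphBall G c L ⊆ graphBall G w₀ R := hball.trans (graphBall_mono G w₀ (by omega))
  have hRl' : RlevA + 1 ≤ (Sch c).R' := by rw [hR' c]; exact hRl
  exact routeClause_of_schedChain hlip hstep hfr hC hD hcert c du.1 (sgOf_sign du) hℓ1x hℓ1y ha₁ hRt₁ hka hkR hkMz hRtL (Sch c)
    (hcore0 c hcB) (hreg c hcB) (hlastMz c hcB) (hreach c hcB)
    (F := Finset.Icc (φ c - fun i => ((a₁ i : ℕ) : ℤ)) (φ c + fun i => ((a₁ i : ℕ) : ℤ))) (Pl := P.farAS x du j) (m := 50 * P.rmax)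
    (fun z hz => Finset.mem_Icc.2 ⟨fun i => by have := (abs_le.1 (hz i)).1; simp only [Pi.sub_apply]; linarith,
      fun i => by have := (abs_le.1 (hz i)).2; simp only [Pi.add_apply]; linarith⟩)
    (hFfar c hcB) (hfar c hcB) P.sub_mem_box_of_mem_farAS hWG hWD (fun u hu => ((mem_Win G φ).1 hu).1) hballR subset_rfl
    (coreT_subset_faceStepW_T hlip hstep hjK hballR (hlast c hcB) hL'1 hL'M) hR₁ hR hRl' hjA hη hcountA (hchain c _ rfl) (hKits c hcB hballR)

end Skelφ

end Summit.CriticalPhenomena.PercolationContinuityZ3.Theorems.Transplant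

end
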